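import Summits.QuantumFields.YangMills.Theorems.LuscherReductionRunningReductionKTPhysSpace
import Summits.QuantumFields.YangMills.Theorems.LuscherReductionRunningReductionRitzBasics
import Literature.Analysis.OperatorTheory.ClusterKatoTempleBound
import HarnessLib

/-!
# Crux RED `RunningReduction`, line «KT»: Ritz values are the sorted Rayleigh–Ritz eigenvalues (Courant–Fischer inside the
# trial space, fixed lattice)

Support module for crux `RunningReduction` (route `LuscherReduction`, item stmt-QuantumFields-19978), line «KT» (owner ym-beyond-p1 g16;
the min–max half of stub `stub_katoTempleDoor`).  For a physical trial family `φ : Fin (k+1) → _` and an `l2`-orthonormal, `qform`-diagonal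
family `u : Fin (k+1) → physSubmodule L` with decreasingly sorted Ritz data `m` spanning the same space (the output of the tree's
`ClusterKatoTemple.exists_orthonormal_formDiagonal_antitone` read through the dictionary of `…KTPhysSpace`), the line's `ritzValue β φ j`
(inf over `j` constraints in the span of the sup of the constrained Rayleigh quotients) EQUALS `m_j` for `j ≤ k`:

* `coe_mem_span_iff` — span bookkeeping between `physSubmodule L` and the function space; `span_coe_eq_span` — an `l2`-orthonormal
  family inside the span of `φ` spans it (dimension count);
* **`ritzValue_le_ritzDiag`** (`ritzValue β φ j ≤ m_j`, constraints `u₀ … u_{j−1}`; tree `rayleigh_le_of_mem_span_of_orthogonal`);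
* **`ritzDiag_le_ritzValue`** (`m_j ≤ ritzValue β φ j`; tree `exists_rayleigh_ge_of_constraints`, rank–nullity inside `span(u₀ … u_j)`).

Fleet service by seat ym-infvol-p2.  HONEST FRAMING: femto rung R2b1, fixed-lattice linear algebra; not infinite volume, not the Clay gap.
References: G. H. Golub, C. F. Van Loan, *Matrix Computations* (2013) Thm 8.1.2 [cite: GolubVanLoan2013, §8.1.1]; M. Reed, B. Simon IV, XIII.1–2.
-/

set_option autoImplicit false

noncomputable section

open MeasureTheory Filter Topology Real
open Literature.MathematicalPhysics.QuantumFieldTheory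
open Literature.MathematicalPhysics.QuantumLattice
open Literature.Analysis.OperatorTheory.YMMatrixModel
open Literature.Analysis.OperatorTheory.ClusterKatoTemple

namespace Summit.QuantumFields.YangMills.Theorems.FemtoTransferGap

variable {L : ℕ} [NeZero L]

/-! ### §1. Span bookkeeping between the physical subspace and the function space -/

omit [NeZero L] in
/-- The image of `span u` under the inclusion of the physical subspace is the span of the underlying functions. [folklore] -/
theorem map_subtype_span_range {n : ℕ} (u : Fin n → physSubmodule L) :
    (Submodule.span ℝ (Set.range u)).map (physSubmodule L).subtype =
      Submodule.span ℝ (Set.range fun i => (u i : GaugeConfig 3 L SU2 → ℝ)) := by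
  rw [Submodule.map_span, ← Set.range_comp]
  rfl

omit [NeZero L] in
/-- `x ∈ span u` in the physical subspace iff `↑x ∈ span (↑u)` in the function space. [folklore] -/
theorem coe_mem_span_iff {n : ℕ} (u : Fin n → physSubmodule L) (x : physSubmodule L) :
    x ∈ Submodule.span ℝ (Set.range u) ↔
      (x : GaugeConfig 3 L SU2 → ℝ) ∈ Submodule.span ℝ (Set.range fun i => (u i : GaugeConfig 3 L SU2 → ℝ)) := by
  rw [← map_subtype_span_range]
  constructor
  · intro hx
    exact Submodule.mem_map_of_mem hx
  · intro h
    obtain ⟨y, hy, hyx⟩ := Submodule.mem_map.1 h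
    have hxy : y = x := Subtype.ext hyx
    rw [← hxy]
    exact hy

/-- An `l2`-orthonormal family of the physical subspace is linearly independent (as functions). [folklore] -/
theorem linearIndependent_coe_of_orthonormal {n : ℕ} (u : Fin n → physSubmodule L)
    (hon : ∀ i l, l2 (u i : GaugeConfig 3 L SU2 → ℝ) (u l) = if i = l then 1 else 0) :
    LinearIndependent ℝ fun i => (u i : GaugeConfig 3 L SU2 → ℝ) := by
  have hD : LinearIndependent ℝ u := by
    rw [Fintype.linearIndependent_iff]
    intro c hc l
    have h := congrArg (fun y => l2Form L (u l) y) hc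
    simp only [map_zero] at h
    rw [Literature.Analysis.OperatorTheory.bilin_sum_smul_right] at h
    simp only [l2Form_apply, hon, mul_ite, mul_one, mul_zero] at h
    simpa [Finset.sum_ite_eq', Finset.mem_univ, eq_comm] using h
  exact hD.map' (physSubmodule L).subtype (Submodule.ker_subtype _)

/-- **An `l2`-orthonormal family of `k+1` physical functions inside the span of `φ : Fin (k+1) → _` spans it** (dimension count).
[folklore] -/
theorem span_coe_eq_span {k : ℕ} (φ : Fin (k + 1) → (GaugeConfig 3 L SU2 → ℝ)) (u : Fin (k + 1) → physSubmodule L)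
    (hu : ∀ i, (u i : GaugeConfig 3 L SU2 → ℝ) ∈ Submodule.span ℝ (Set.range φ))
    (hon : ∀ i l, l2 (u i : GaugeConfig 3 L SU2 → ℝ) (u l) = if i = l then 1 else 0) :
    Submodule.span ℝ (Set.range fun i => (u i : GaugeConfig 3 L SU2 → ℝ)) = Submodule.span ℝ (Set.range φ) := by
  haveI : FiniteDimensional ℝ (Submodule.span ℝ (Set.range φ)) := FiniteDimensional.span_of_finite ℝ (Set.finite_range φ)
  refine Submodule.eq_of_le_of_finrank_le (Submodule.span_le.mpr ?_) ?_
  · rintro _ ⟨i, rfl⟩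
    exact hu i
  · rw [finrank_span_eq_card (linearIndependent_coe_of_orthonormal u hon), Fintype.card_fin]
    have h := finrank_range_le_card (R := ℝ) φ
    rw [Fintype.card_fin] at h
    exact h

/-! ### §2. Ritz values versus the sorted Ritz diagonal -/

section RitzDiag

variable {β : ℝ} {k : ℕ} {φ : Fin (k + 1) → (GaugeConfig 3 L SU2 → ℝ)} {u : Fin (k + 1) → physSubmodule L} {m : Fin (k + 1) → ℝ}

/-- **Upper half: `ritzValue β φ j ≤ m_j`** (`j ≤ k`) for an `l2`-orthonormal `qform`-diagonal family `u` with antitone Ritz data `m`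
spanning `span φ` — constraints `u₀, …, u_{j−1}`; on their orthogonal complement inside the span the Rayleigh quotient is `≤ m_j`.
[cite: GolubVanLoan2013, §8.1.1] -/
theorem ritzValue_le_ritzDiag (hβ : 0 ≤ β) (hφ : ∀ i, IsPhys (φ i))
    (hu : ∀ i, (u i : GaugeConfig 3 L SU2 → ℝ) ∈ Submodule.span ℝ (Set.range φ))
    (hon : ∀ i l, l2 (u i : GaugeConfig 3 L SU2 → ℝ) (u l) = if i = l then 1 else 0)
    (hdiag : ∀ i l, qform su2Rep β (u i : GaugeConfig 3 L SU2 → ℝ) (u l) = if i = l then m i else 0)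
    (hanti : Antitone m) {j : ℕ} (hj : j ≤ k) :
    ritzValue β φ j ≤ m ⟨j, Nat.lt_succ_of_le hj⟩ := by
  set jF : Fin (k + 1) := ⟨j, Nat.lt_succ_of_le hj⟩ with hjF
  have hspan := span_coe_eq_span φ u hu hon
  -- the Ritz diagonal entries are non-negative
  have hm0 : 0 ≤ m jF := by
    have h := hdiag jF jF
    rw [if_pos rfl] at h
    rw [← h]
    exact qform_su2Rep_self_nonneg hβ (isPhys_coe _)
  -- constraints `χ i = u i`, `i < j`
  let χ : Fin j → (GaugeConfig 3 L SU2 → ℝ) := fun i => (u ⟨i.val, by omega⟩ : GaugeConfig 3 L SU2 → ℝ)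
  have hχ : ∀ i, χ i ∈ Submodule.span ℝ (Set.range φ) := fun i => hu _
  have hbdd : BddBelow {s | ∃ χ' : Fin j → (GaugeConfig 3 L SU2 → ℝ), (∀ i, χ' i ∈ Submodule.span ℝ (Set.range φ)) ∧
      s = sSup {r | ∃ ψ ∈ Submodule.span ℝ (Set.range φ), (∀ i, l2 ψ (χ' i) = 0) ∧ 0 < l2 ψ ψ ∧
        r = qform su2Rep β ψ ψ / l2 ψ ψ}} := by
    refine ⟨0, ?_⟩
    rintro s ⟨χ', -, rfl⟩
    refine Real.sSup_nonneg ?_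
    rintro r ⟨ψ, hψ, -, hpos, rfl⟩
    exact div_nonneg (qform_su2Rep_self_nonneg hβ (isPhys_of_mem_span hφ hψ)) hpos.le
  refine (csInf_le hbdd ⟨χ, hχ, rfl⟩).trans (Real.sSup_le ?_ hm0)
  rintro r ⟨ψ, hψ, horth, hpos, rfl⟩
  rw [div_le_iff₀ hpos]
  -- read through the dictionary
  set x : physSubmodule L := ⟨ψ, isPhys_of_mem_span hφ hψ⟩ with hx
  have hxspan : x ∈ Submodule.span ℝ (Set.range u) := by
    rw [coe_mem_span_iff, hspan]
    exact hψ
  have hon' : ∀ i l, l2Form L (u i) (u l) = if i = l then 1 else 0 := fun i l => by rw [l2Form_apply, hon]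
  have hdiag' : ∀ i l, ((l2Form L).compl₂ (transferOp β)) (u i) (u l) = if i = l then m i else 0 := fun i l => by
    rw [LinearMap.compl₂_apply, l2Form_transferOp_right, hdiag]
  have hmhi : ∀ i : Fin (k + 1), j ≤ i.val → m i ≤ m jF := fun i hi => hanti (show jF ≤ i from hi)
  have hperp : ∀ i : Fin (k + 1), i.val < j → l2Form L (u i) x = 0 := by
    intro i hi
    rw [l2Form_apply, l2_comm]
    exact horth ⟨i.val, hi⟩
  have h := rayleigh_le_of_mem_span_of_orthogonal (l2Form L) ((l2Form L).compl₂ (transferOp β)) u m hon' hdiag' hmhi hxspan hperp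
  rw [LinearMap.compl₂_apply, l2Form_transferOp_right, l2Form_apply] at h
  exact h

/-- **Lower half (sharpness): `m_j ≤ ritzValue β φ j`** (`j ≤ k`) — no `j` constraints in the span push the sup of the Rayleigh quotient
below `m_j` (a normalised vector of `span(u₀, …, u_j)` satisfying them exists by rank–nullity). [cite: GolubVanLoan2013, §8.1.1] -/
theorem ritzDiag_le_ritzValue (hφ : ∀ i, IsPhys (φ i))
    (hu : ∀ i, (u i : GaugeConfig 3 L SU2 → ℝ) ∈ Submodule.span ℝ (Set.range φ))
    (hon : ∀ i l, l2 (u i : GaugeConfig 3 L SU2 → ℝ) (u l) = if i = l then 1 else 0)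
    (hdiag : ∀ i l, qform su2Rep β (u i : GaugeConfig 3 L SU2 → ℝ) (u l) = if i = l then m i else 0)
    (hanti : Antitone m) {j : ℕ} (hj : j ≤ k) :
    m ⟨j, Nat.lt_succ_of_le hj⟩ ≤ ritzValue β φ j := by
  set jF : Fin (k + 1) := ⟨j, Nat.lt_succ_of_le hj⟩ with hjF
  have hspan := span_coe_eq_span φ u hu hon
  have hon' : ∀ i l, l2Form L (u i) (u l) = if i = l then 1 else 0 := fun i l => by rw [l2Form_apply, hon]
  have hdiag' : ∀ i l, ((l2Form L).compl₂ (transferOp β)) (u i) (u l) = if i = l then m i else 0 := fun i l => by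
    rw [LinearMap.compl₂_apply, l2Form_transferOp_right, hdiag]
  have hmlo : ∀ i : Fin (k + 1), i.val ≤ j → m jF ≤ m i := fun i hi => hanti (show i ≤ jF from hi)
  refine le_csInf ⟨_, fun _ => 0, fun _ => Submodule.zero_mem _, rfl⟩ ?_
  rintro s ⟨χ', hχ', rfl⟩
  -- the `j` constraints as functionals on the physical subspace
  let f : Fin j → physSubmodule L →ₗ[ℝ] ℝ := fun l => l2Form L ⟨χ' l, isPhys_of_mem_span hφ (hχ' l)⟩
  obtain ⟨x, hxspan, hx1, hxf, hxm⟩ :=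
    exists_rayleigh_ge_of_constraints (l2Form L) ((l2Form L).compl₂ (transferOp β)) u m hon' hdiag'
      (Nat.lt_succ_of_le hj) hmlo f
  rw [LinearMap.compl₂_apply, l2Form_transferOp_right] at hxm
  rw [l2Form_apply] at hx1
  have hψspan : (x : GaugeConfig 3 L SU2 → ℝ) ∈ Submodule.span ℝ (Set.range φ) := by
    rw [← hspan, ← coe_mem_span_iff]
    exact hxspan
  have horth : ∀ l, l2 (x : GaugeConfig 3 L SU2 → ℝ) (χ' l) = 0 := fun l => by
    have h := hxf l
    simp only [f, l2Form_apply] at h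
    rw [l2_comm]
    exact h
  have hpos : 0 < l2 (x : GaugeConfig 3 L SU2 → ℝ) x := by rw [hx1]; exact one_pos
  have hbddT : BddAbove {r | ∃ ψ ∈ Submodule.span ℝ (Set.range φ), (∀ i, l2 ψ (χ' i) = 0) ∧ 0 < l2 ψ ψ ∧
      r = qform su2Rep β ψ ψ / l2 ψ ψ} := by
    refine ⟨levelValue su2Rep L β 0, ?_⟩
    rintro r ⟨ψ, hψ, -, hψpos, rfl⟩
    exact rayleigh_le_levelValue_zero su2Rep continuous_su2Rep β (isPhys_of_mem_span hφ hψ) hψpos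
  refine le_trans ?_ (le_csSup hbddT ⟨(x : GaugeConfig 3 L SU2 → ℝ), hψspan, horth, hpos, rfl⟩)
  rw [hx1, div_one]
  exact hxm

/-- **Courant–Fischer inside the trial space**: `ritzValue β φ j = m_j` for `j ≤ k`. [cite: GolubVanLoan2013, §8.1.1] -/
theorem ritzValue_eq_ritzDiag (hβ : 0 ≤ β) (hφ : ∀ i, IsPhys (φ i))
    (hu : ∀ i, (u i : GaugeConfig 3 L SU2 → ℝ) ∈ Submodule.span ℝ (Set.range φ))
    (hon : ∀ i l, l2 (u i : GaugeConfig 3 L SU2 → ℝ) (u l) = if i = l then 1 else 0)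
    (hdiag : ∀ i l, qform su2Rep β (u i : GaugeConfig 3 L SU2 → ℝ) (u l) = if i = l then m i else 0)
    (hanti : Antitone m) {j : ℕ} (hj : j ≤ k) :
    ritzValue β φ j = m ⟨j, Nat.lt_succ_of_le hj⟩ :=
  le_antisymm (ritzValue_le_ritzDiag hβ hφ hu hon hdiag hanti hj) (ritzDiag_le_ritzValue hφ hu hon hdiag hanti hj)

end RitzDiag

end Summit.QuantumFields.YangMills.Theorems.FemtoTransferGap

end
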